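import Summits.QuantumFields.BalabanUV.Beta.D1BFx.CoframeVertices
import Summits.QuantumFields.BalabanUV.Beta.D1BFx.ReducedKernelF
import Summits.QuantumFields.BalabanUV.Beta.D1BFx.ProfileWordCount

/-!
# `BalabanUV.Beta.D1BFx.GhostVertexOrientation` — road «BF-x» for binder row D1, slot (K), GHOST-N8-SPEC v0.2 §3″ FILE F1 «ORIENTATION»:
# **A LEG COMPOSED WITH THE PACKED GHOST CURRENT IS ONE RIGHT-END DIFFERENCE OF THE LEG WEIGHTED BY THE COLUMN, PLUS THE UNDIFFERENCED LEG
# WEIGHTED BY THE COLUMN's BACKWARD DIFFERENCE** — pointwise, for ANY leg; and the two-term (profile × density) majorant that follows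

HONEST DEPENDENCY (cell records, verbatim): «continuum YM on T⁴ ⇐ BetaPertH ∧ nine spine estimates (0/9 proved); BetaPertH ⇐ (D1) ∧ (D4) ∧
CAP+tail; G-an2-4 gates asym, D1 and NE2/3/4.»  HONEST FRAMING (cell contract, verbatim): «discharging `BetaPertH` makes Bałaban's UV stability
UNCONDITIONAL — a real constructive-QFT result; it is NOT the continuum limit and NOT the Clay problem.»  THIS MODULE DISCHARGES NOTHING of the
wall: [folklore] two-point `tsum` bookkeeping over gan24-leaf-05's `CoframeVertices.gW_apply` (the packed ghost current `gW w = Σ_κ wsum (w κ) ghCur_κ`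
in closed form), this lineage's `ReducedKernelF.vertexRedF` (the road's chain-rule vertex) and `ProfileWordCount` (the `nrm`∕`supNorm` shift tools);
the leg `L` and the weights `w` are ARBITRARY, every letter about them is a DISPLAYED hypothesis.  No definition, no `def … : Prop`, nothing cited,
0 sorry.  0 root-level binders of row D1 discharged (hW ∕ hR-sockets ∕ hSX-socket ∕ D1Tel ∕ D1Rep = 0); (K) NOT closed; NOT D1, NOT `BetaPertH`,
NOT continuum, NOT Clay.

ABSOLUTE RULE (cell charter, verbatim): «No internally-minted statement may enter as a cited fact. Every hypothesis is either kernel-proved in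
this package or a verbatim quotation of a PUBLISHED theorem with page reference. The manuscript(s) under audit are NOT citable for their own
disputed steps — they are the thing under adjudication; programme-internal (2001/route/tribunal) claims are never citable.»

WHY (GHOST-N8-SPEC v0.2 §3″, journal N-1 [D1LEAF04-G26-N1]).  The twelve ghost rest words of slot (K) (`RestKernelGhostWords.ghostWord`) are
`biBubble L₁ V L₂ V′ = tr (comp (comp L₁ V) (comp L₂ V′))` and `tadpole L W` at the road's ghost vertex `V = 𝒱 μ y = n²•vertexRedF n ghCur μ y`,
i.e. (§2) the packed current `gW w` at the weights `w κ u = n²·wH κ μ (u − n•y)`.  `biBubble` composes each vertex on the RIGHT END of the leg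
before it; this file shows what that composition IS (§1): since `wsum w (ghCur κ)` is the two-point kernel `w(z)·[y = z+e_κ] − w(y)·[z = y+e_κ]`,
`comp L (gW w) (x,z) = Σ_κ (w κ z·L(x,z+e_κ) − w κ (z−e_κ)·L(x,z−e_κ)) = Σ_κ (w κ z·[L(x,z+e_κ) − L(x,z−e_κ)] + [w κ z − w κ (z−e_κ)]·L(x,z−e_κ))`
— ONE symmetric difference on the leg's right end weighted by the column, plus the leg undifferenced weighted by the column's backward difference
(the lattice form of `∫ w(ψ̄∂ψ − ∂ψ̄ψ) = 2∫ wψ̄∂ψ + ∫ (∂w)ψ̄ψ`).  No summation by parts, no trace cyclicity: the vertex after `L₁` never touches `L₂`.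
With the leg's VALUE and RIGHT-DIFFERENCE profiles and the column's VALUE and BACKWARD-DIFFERENCE densities displayed, §3 is the two-term majorant
`|comp L (gW w) (x,z)| ≤ (K′∕nrm(x−z)^{a′} + K∕nrm(x−z)^{a})·e^{−(δ∕n)‖x−z‖∞}·e^{−(σ∕n)‖z−C‖∞}` that FILE F2 («oriented profile words») turns into four
sub-critical double Riesz counts per word (every exponent sum `≤ D − 1` for the twelve words, §3″ (O6)), hence `O(n⁻⁸)` rows per word.

CONTENT ([folklore]; `D = 4`, fibre `Unit` — the ghost's; `w : Fin 4 → Site 4 → ℝ`, `L : MKer 4 Unit` arbitrary).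
* §1 **`comp_gW_apply`** (`comp L (gW w) x z = Σ_κ (w κ z·L x (z+e_κ) − w κ (z−e_κ)·L x (z−e_κ))`), **`comp_gW_eq_oriented`** (the oriented form),
  the mirrors **`gW_comp_apply`**, **`gW_comp_eq_oriented`** (`comp (gW w) L`: one LEFT-end difference, weight `−w`; backward difference of `w`).
* §2 the road's vertex IS a packed current: **`vertexRedF_ghCur_eq_gW`** (`vertexRedF n ghCur μ y = gW (κ u ↦ wH κ μ (u − n•y))`, `rfl`-level),
  **`smul_gW`** (`c•gW w = gW (c·w)`), **`smul_vertexRedF_ghCur_eq_gW`**.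
* §3 **`abs_comp_gW_le`**: leg letters `|L x y| ≤ κ∕nrm(x−y)^a·e^{−(δ∕n)‖x−y‖∞}`, `|L x (y+e_μ) − L x y| ≤ κ′∕nrm(x−y)^{a′}·e^{…}`; weight letters
  `|w κ z| ≤ A·e^{−(σ∕n)‖z−C‖∞}`, `|w κ z − w κ (z−e_κ)| ≤ A′·e^{−(σ∕n)‖z−C‖∞}` (`0 ≤ δ`, `1 ≤ n`) ⟹
  `|comp L (gW w) x z| ≤ (4·(1 + 2^{a′}·e^{δ})·A·κ′∕nrm(x−z)^{a′} + 4·2^{a}·e^{δ}·A′·κ∕nrm(x−z)^{a})·e^{−(δ∕n)‖x−z‖∞}·e^{−(σ∕n)‖z−C‖∞}`;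
  the mirror **`abs_gW_comp_le`** (left-end letters, centre on the first variable).
NOT HERE (honest): the leg letters themselves (F3: β2 ∕ `ProjectorSupNorm` ∕ composites), the weight letters (F4: `PackedColumnEnvelope` ∕ L-h in
`supNorm` form), the word letter (F2) and the rows (F5); any statement at the END's weights.
Unit `b2b-balaban-beta-d1-formalise-leaf-04` (gen 26), D1 formalisation swarm, road «BF-x»; INTENT-1 [D1LEAF04-G26-INTENT-1]. Not in print; no existing file touched.
-/

noncomputable section

namespace Summit.QuantumFields.BalabanUV.Beta.D1BFx.GhostVertexOrientation

open scoped BigOperators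
open Finset
open Literature.MathematicalPhysics.QuantumFieldTheory.Balaban1983to89
open Literature.MathematicalPhysics.QuantumFieldTheory.Balaban1983to89.Beta
open ExpKernelCalculus (Site MKer comp)
open AffineAveraging (unitVec)
open OneStepResolventKernel (wsum)
open KernelSpecInstance (wH)
open PoissonInterior (supNorm nrm nrm_pos one_le_nrm supNorm_neg)
open Summit.QuantumFields.BalabanUV.Beta.D1BFx.GhostStencil (ghCur ghCur_apply)
open Summit.QuantumFields.BalabanUV.Beta.D1BFx.GhostStencilReflection (add_unitVec_ne_self)
open Summit.QuantumFields.BalabanUV.Beta.D1BFx.PackedCoframeSiteWords (gW)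
open Summit.QuantumFields.BalabanUV.Beta.D1BFx.CoframeVertices (gW_apply)
open Summit.QuantumFields.BalabanUV.Beta.D1BFx.ReducedKernelF (vertexRedF)
open Summit.QuantumFields.BalabanUV.Beta.D1BFx.ProfileWordCount (inv_nrm_pow_le_of_near exp_shift_of_near)

variable (w : Fin 4 → Site 4 → ℝ)

/-! ## §1 A leg composed with the packed current: closed and oriented forms -/

/-- [folklore] `supNorm (± e_κ) = 1`-type fact used for the shift tolerance: `‖(z − e_κ) − z‖∞ ≤ 1`. -/
theorem supNorm_sub_unitVec_sub_le (z : Site 4) (κ : Fin 4) : supNorm (z - unitVec κ - z) ≤ 1 := by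
  rw [show z - unitVec κ - z = -(unitVec κ : Site 4) by abel, supNorm_neg]
  refine PoissonInterior.supNorm_le_iff.2 fun i => ?_
  rw [AffineAveraging.unitVec_apply]
  split_ifs <;> simp

/-- [folklore] … and `‖(x + e_κ) − x‖∞ ≤ 1`. -/
theorem supNorm_add_unitVec_sub_le (x : Site 4) (κ : Fin 4) : supNorm (x + unitVec κ - x) ≤ 1 := by
  rw [show x + unitVec κ - x = (unitVec κ : Site 4) by abel]
  refine PoissonInterior.supNorm_le_iff.2 fun i => ?_
  rw [AffineAveraging.unitVec_apply]
  split_ifs <;> simp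

/-- [folklore] **A LEG COMPOSED WITH THE PACKED GHOST CURRENT, CLOSED FORM**: for ANY `L : MKer 4 Unit`,
`comp L (gW w) x z = Σ_κ (w κ z · L x (z + e_κ) − w κ (z − e_κ) · L x (z − e_κ))` — the `tsum` over the middle site has two-point support per direction. -/
theorem comp_gW_apply (L : MKer 4 Unit) (x z : Site 4) (a b : Unit) :
    comp L (gW w) x z a b = ∑ κ : Fin 4, (w κ z * L x (z + unitVec κ) () () - w κ (z - unitVec κ) * L x (z - unitVec κ) () ()) := by
  obtain rfl : a = () := Subsingleton.elim _ _
  obtain rfl : b = () := Subsingleton.elim _ _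
  unfold ExpKernelCalculus.comp
  simp only [Fintype.sum_unique, PUnit.default_eq_unit]
  have hterm : ∀ κ : Fin 4, HasSum (fun y : Site 4 => L x y () () *
      ((if y = z + unitVec κ then w κ z else 0) - (if z = y + unitVec κ then w κ y else 0)))
      (w κ z * L x (z + unitVec κ) () () - w κ (z - unitVec κ) * L x (z - unitVec κ) () ()) := by
    intro κ
    have e1 : (fun y : Site 4 => L x y () () * (if y = z + unitVec κ then w κ z else 0))
        = fun y => if y = z + unitVec κ then w κ z * L x (z + unitVec κ) () () else 0 := by
      funext y
      by_cases hy : y = z + unitVec κ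
      · rw [if_pos hy, if_pos hy, hy, mul_comm]
      · rw [if_neg hy, if_neg hy, mul_zero]
    have e2 : (fun y : Site 4 => L x y () () * (if z = y + unitVec κ then w κ y else 0))
        = fun y => if y = z - unitVec κ then w κ (z - unitVec κ) * L x (z - unitVec κ) () () else 0 := by
      funext y
      by_cases hy : y = z - unitVec κ
      · have hz : z = y + unitVec κ := by rw [hy]; abel
        rw [if_pos hz, if_pos hy, hy, mul_comm]
      · have hz : ¬ z = y + unitVec κ := fun h => hy (by rw [h]; abel)
        rw [if_neg hz, if_neg hy, mul_zero]
    have h1 : HasSum (fun y : Site 4 => L x y () () * (if y = z + unitVec κ then w κ z else 0)) (w κ z * L x (z + unitVec κ) () ()) := by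
      rw [e1]; exact hasSum_ite_eq _ _
    have h2 : HasSum (fun y : Site 4 => L x y () () * (if z = y + unitVec κ then w κ y else 0))
        (w κ (z - unitVec κ) * L x (z - unitVec κ) () ()) := by
      rw [e2]; exact hasSum_ite_eq _ _
    have h12 := h1.sub h2
    refine h12.congr_fun fun y => ?_
    ring
  have hsum : HasSum (fun y : Site 4 => L x y () () * gW w y z () ())
      (∑ κ : Fin 4, (w κ z * L x (z + unitVec κ) () () - w κ (z - unitVec κ) * L x (z - unitVec κ) () ())) := by
    have h := hasSum_sum (s := (Finset.univ : Finset (Fin 4))) (fun κ _ => hterm κ)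
    refine h.congr_fun fun y => ?_
    rw [gW_apply, Finset.mul_sum]
  exact hsum.tsum_eq

/-- [folklore] **THE ORIENTED FORM (right end)**: `comp L (gW w) x z = Σ_κ (w κ z·[L x (z+e_κ) − L x (z−e_κ)] + [w κ z − w κ (z−e_κ)]·L x (z−e_κ))` —
ONE symmetric difference on `L`'s right end weighted by the column, plus `L` undifferenced weighted by the column's backward difference. -/
theorem comp_gW_eq_oriented (L : MKer 4 Unit) (x z : Site 4) (a b : Unit) :
    comp L (gW w) x z a b = ∑ κ : Fin 4, (w κ z * (L x (z + unitVec κ) () () - L x (z - unitVec κ) () ())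
      + (w κ z - w κ (z - unitVec κ)) * L x (z - unitVec κ) () ()) := by
  rw [comp_gW_apply]; exact Finset.sum_congr rfl fun κ _ => by ring

/-- [folklore] **THE MIRROR, CLOSED FORM**: `comp (gW w) L x z = Σ_κ (w κ (x − e_κ) · L (x − e_κ) z − w κ x · L (x + e_κ) z)`. -/
theorem gW_comp_apply (L : MKer 4 Unit) (x z : Site 4) (a b : Unit) :
    comp (gW w) L x z a b = ∑ κ : Fin 4, (w κ (x - unitVec κ) * L (x - unitVec κ) z () () - w κ x * L (x + unitVec κ) z () ()) := by
  obtain rfl : a = () := Subsingleton.elim _ _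
  obtain rfl : b = () := Subsingleton.elim _ _
  unfold ExpKernelCalculus.comp
  simp only [Fintype.sum_unique, PUnit.default_eq_unit]
  have hterm : ∀ κ : Fin 4, HasSum (fun y : Site 4 =>
      ((if x = y + unitVec κ then w κ y else 0) - (if y = x + unitVec κ then w κ x else 0)) * L y z () ())
      (w κ (x - unitVec κ) * L (x - unitVec κ) z () () - w κ x * L (x + unitVec κ) z () ()) := by
    intro κ
    have e1 : (fun y : Site 4 => (if x = y + unitVec κ then w κ y else 0) * L y z () ())
        = fun y => if y = x - unitVec κ then w κ (x - unitVec κ) * L (x - unitVec κ) z () () else 0 := by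
      funext y
      by_cases hy : y = x - unitVec κ
      · have hx : x = y + unitVec κ := by rw [hy]; abel
        rw [if_pos hx, if_pos hy, hy]
      · have hx : ¬ x = y + unitVec κ := fun h => hy (by rw [h]; abel)
        rw [if_neg hx, if_neg hy, zero_mul]
    have e2 : (fun y : Site 4 => (if y = x + unitVec κ then w κ x else 0) * L y z () ())
        = fun y => if y = x + unitVec κ then w κ x * L (x + unitVec κ) z () () else 0 := by
      funext y
      by_cases hy : y = x + unitVec κ
      · rw [if_pos hy, if_pos hy, hy]
      · rw [if_neg hy, if_neg hy, zero_mul]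
    have h1 : HasSum (fun y : Site 4 => (if x = y + unitVec κ then w κ y else 0) * L y z () ())
        (w κ (x - unitVec κ) * L (x - unitVec κ) z () ()) := by
      rw [e1]; exact hasSum_ite_eq _ _
    have h2 : HasSum (fun y : Site 4 => (if y = x + unitVec κ then w κ x else 0) * L y z () ()) (w κ x * L (x + unitVec κ) z () ()) := by
      rw [e2]; exact hasSum_ite_eq _ _
    have h12 := h1.sub h2
    refine h12.congr_fun fun y => ?_
    ring
  have hsum : HasSum (fun y : Site 4 => gW w x y () () * L y z () ())
      (∑ κ : Fin 4, (w κ (x - unitVec κ) * L (x - unitVec κ) z () () - w κ x * L (x + unitVec κ) z () ())) := by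
    have h := hasSum_sum (s := (Finset.univ : Finset (Fin 4))) (fun κ _ => hterm κ)
    refine h.congr_fun fun y => ?_
    rw [gW_apply, Finset.sum_mul]
  exact hsum.tsum_eq

/-- [folklore] **THE MIRROR, ORIENTED (left end)**: `comp (gW w) L x z = Σ_κ (−w κ x·[L (x+e_κ) z − L (x−e_κ) z] − [w κ x − w κ (x−e_κ)]·L (x−e_κ) z)`. -/
theorem gW_comp_eq_oriented (L : MKer 4 Unit) (x z : Site 4) (a b : Unit) :
    comp (gW w) L x z a b = ∑ κ : Fin 4, (-(w κ x * (L (x + unitVec κ) z () () - L (x - unitVec κ) z () ()))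
      - (w κ x - w κ (x - unitVec κ)) * L (x - unitVec κ) z () ()) := by
  rw [gW_comp_apply]; exact Finset.sum_congr rfl fun κ _ => by ring

/-! ## §2 The road's ghost vertex is a packed current -/

/-- [our object] **THE ROAD's CHAIN-RULE GHOST VERTEX IS THE PACKED CURRENT AT THE COLUMN WEIGHTS**:
`vertexRedF n ghCur μ y = gW (κ u ↦ wH κ μ (u − n•y))` (both bodies are `Σ_κ wsum (…) (ghCur κ)`). -/
theorem vertexRedF_ghCur_eq_gW (n : ℕ) [NeZero n] (μ : Fin 4) (y : Site 4) :
    vertexRedF n (fun κ u => ghCur κ u) μ y = gW (fun κ u => wH (N := n) (d := 3) κ μ (u - (n : ℤ) • y)) := rfl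

/-- [folklore] Scalars enter the weights: `c • gW w = gW (κ u ↦ c·w κ u)`. -/
theorem smul_gW (c : ℝ) : c • gW w = gW (fun κ u => c * w κ u) := by
  funext x z a b
  show c * (∑ κ : Fin 4, wsum (w κ) (ghCur κ) x z a b) = ∑ κ : Fin 4, wsum (fun u => c * w κ u) (ghCur κ) x z a b
  rw [Finset.mul_sum]
  refine Finset.sum_congr rfl fun κ _ => ?_
  unfold OneStepResolventKernel.wsum
  rw [← tsum_mul_left]
  exact tsum_congr fun u => by ring

/-- [our object] **THE SCALED ROAD VERTEX** (the `n²•vertexRedF n ghCur μ y` of `RestKernelGhostUnitRow`): `c • vertexRedF n ghCur μ y = gW (κ u ↦ c·wH κ μ (u − n•y))`. -/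
theorem smul_vertexRedF_ghCur_eq_gW (n : ℕ) [NeZero n] (c : ℝ) (μ : Fin 4) (y : Site 4) :
    c • vertexRedF n (fun κ u => ghCur κ u) μ y = gW (fun κ u => c * wH (N := n) (d := 3) κ μ (u - (n : ℤ) • y)) := by
  rw [vertexRedF_ghCur_eq_gW, smul_gW]

/-! ## §3 The two-term majorant: leg value ∕ right-difference profiles × column value ∕ backward-difference densities -/

section Majorant

variable {w} {L : MKer 4 Unit} {n : ℕ} (hn : 1 ≤ n) {κ₀ κ₁ A A' δ σ : ℝ} {a a' : ℕ} {C : Site 4}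
  (hκ₀ : 0 ≤ κ₀) (hκ₁ : 0 ≤ κ₁) (hδ : 0 ≤ δ)

include hn hκ₀ hκ₁ hδ

/-- [folklore] **THE RIGHT-END MAJORANT.**  VALUE profile `|L x y| ≤ κ₀∕nrm(x−y)^a·e^{−(δ∕n)‖x−y‖∞}`, RIGHT-DIFFERENCE profile
`|L x (y+e_μ) − L x y| ≤ κ₁∕nrm(x−y)^{a′}·e^{−(δ∕n)‖x−y‖∞}`; column VALUE density `|w κ z| ≤ A·e^{−(σ∕n)‖z−C‖∞}` and BACKWARD-DIFFERENCE density
`|w κ z − w κ (z−e_κ)| ≤ A′·e^{−(σ∕n)‖z−C‖∞}` ⟹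
`|comp L (gW w) x z| ≤ (4·(1 + 2^{a′}·e^{δ})·A·κ₁∕nrm(x−z)^{a′} + 4·2^{a}·e^{δ}·A′·κ₀∕nrm(x−z)^{a})·e^{−(δ∕n)‖x−z‖∞}·e^{−(σ∕n)‖z−C‖∞}`
(the shifted arguments `z − e_κ` cost `2^{·}` on `nrm` and `e^{δ∕n} ≤ e^{δ}` on the damping: `ProfileWordCount.inv_nrm_pow_le_of_near ∕ exp_shift_of_near`). -/
theorem abs_comp_gW_le
    (hL : ∀ x y, |L x y () ()| ≤ κ₀ / nrm (x - y) ^ a * Real.exp (-(δ / n) * supNorm (x - y)))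
    (hdL : ∀ x y (μ : Fin 4), |L x (y + unitVec μ) () () - L x y () ()| ≤ κ₁ / nrm (x - y) ^ a' * Real.exp (-(δ / n) * supNorm (x - y)))
    (hw : ∀ κ z, |w κ z| ≤ A * Real.exp (-(σ / n) * supNorm (z - C)))
    (hdw : ∀ κ z, |w κ z - w κ (z - unitVec κ)| ≤ A' * Real.exp (-(σ / n) * supNorm (z - C)))
    (x z : Site 4) (a₀ b₀ : Unit) :
    |comp L (gW w) x z a₀ b₀| ≤ (4 * (1 + 2 ^ a' * Real.exp δ) * A * κ₁ / nrm (x - z) ^ a' + 4 * 2 ^ a * Real.exp δ * A' * κ₀ / nrm (x - z) ^ a)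
      * Real.exp (-(δ / n) * supNorm (x - z)) * Real.exp (-(σ / n) * supNorm (z - C)) := by
  have hn0 : (0 : ℝ) < n := by exact_mod_cast hn
  have hδn : 0 ≤ δ / n := div_nonneg hδ hn0.le
  have hδn' : Real.exp (δ / n * (1 : ℕ)) ≤ Real.exp δ := by
    rw [Nat.cast_one, mul_one]; exact Real.exp_le_exp.2 (div_le_self hδ (by exact_mod_cast hn))
  set E : ℝ := Real.exp (-(δ / n) * supNorm (x - z)) with hE
  set W : ℝ := Real.exp (-(σ / n) * supNorm (z - C)) with hW
  have hE0 : 0 ≤ E := (Real.exp_pos _).le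
  have hW0 : 0 ≤ W := (Real.exp_pos _).le
  have hq := nrm_pos (x - z)
  -- the per-direction bound
  have hκ : ∀ κ : Fin 4, |w κ z * (L x (z + unitVec κ) () () - L x (z - unitVec κ) () ())
      + (w κ z - w κ (z - unitVec κ)) * L x (z - unitVec κ) () ()|
      ≤ ((1 + 2 ^ a' * Real.exp δ) * A * κ₁ / nrm (x - z) ^ a' + 2 ^ a * Real.exp δ * A' * κ₀ / nrm (x - z) ^ a) * E * W := by
    intro κ
    have hnear : supNorm (z - unitVec κ - z) ≤ 1 := supNorm_sub_unitVec_sub_le z κ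
    -- shifted profile factors at `z − e_κ`
    have hpow' := inv_nrm_pow_le_of_near (x := x) hnear a'
    have hpow := inv_nrm_pow_le_of_near (x := x) hnear a
    have hexp := (exp_shift_of_near (x := x) (w := C) hnear hδn).1
    -- (1) forward difference at `z`
    have d1 : |L x (z + unitVec κ) () () - L x z () ()| ≤ κ₁ / nrm (x - z) ^ a' * E := hdL x z κ
    -- (2) the difference ending at `z`, based at `z − e_κ`
    have d2 : |L x z () () - L x (z - unitVec κ) () ()| ≤ 2 ^ a' * Real.exp δ * (κ₁ / nrm (x - z) ^ a') * E := by
      have h := hdL x (z - unitVec κ) κ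
      rw [sub_add_cancel] at h
      refine h.trans ?_
      have t1 : κ₁ / nrm (x - (z - unitVec κ)) ^ a' ≤ 2 ^ a' * (κ₁ / nrm (x - z) ^ a') := by
        have := mul_le_mul_of_nonneg_left hpow' hκ₁
        calc κ₁ / nrm (x - (z - unitVec κ)) ^ a' = κ₁ * (1 / nrm (x - (z - unitVec κ)) ^ a') := by ring
          _ ≤ κ₁ * ((((1 : ℕ) : ℝ) + 1) ^ a' / nrm (x - z) ^ a') := this
          _ = 2 ^ a' * (κ₁ / nrm (x - z) ^ a') := by norm_num; ring
      have t2 : Real.exp (-(δ / n) * supNorm (x - (z - unitVec κ))) ≤ Real.exp δ * E := by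
        refine hexp.trans ?_
        exact mul_le_mul_of_nonneg_right hδn' hE0
      have t10 : 0 ≤ κ₁ / nrm (x - (z - unitVec κ)) ^ a' := by have := nrm_pos (x - (z - unitVec κ)); positivity
      calc κ₁ / nrm (x - (z - unitVec κ)) ^ a' * Real.exp (-(δ / n) * supNorm (x - (z - unitVec κ)))
          ≤ (2 ^ a' * (κ₁ / nrm (x - z) ^ a')) * (Real.exp δ * E) := mul_le_mul t1 t2 (Real.exp_pos _).le (t10.trans t1)
        _ = _ := by ring
    -- (3) the value at `z − e_κ`
    have d3 : |L x (z - unitVec κ) () ()| ≤ 2 ^ a * Real.exp δ * (κ₀ / nrm (x - z) ^ a) * E := by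
      have h := hL x (z - unitVec κ)
      refine h.trans ?_
      have t1 : κ₀ / nrm (x - (z - unitVec κ)) ^ a ≤ 2 ^ a * (κ₀ / nrm (x - z) ^ a) := by
        have := mul_le_mul_of_nonneg_left hpow hκ₀
        calc κ₀ / nrm (x - (z - unitVec κ)) ^ a = κ₀ * (1 / nrm (x - (z - unitVec κ)) ^ a) := by ring
          _ ≤ κ₀ * ((((1 : ℕ) : ℝ) + 1) ^ a / nrm (x - z) ^ a) := this
          _ = 2 ^ a * (κ₀ / nrm (x - z) ^ a) := by norm_num; ring
      have t2 : Real.exp (-(δ / n) * supNorm (x - (z - unitVec κ))) ≤ Real.exp δ * E := by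
        refine hexp.trans ?_
        exact mul_le_mul_of_nonneg_right hδn' hE0
      have t10 : 0 ≤ κ₀ / nrm (x - (z - unitVec κ)) ^ a := by have := nrm_pos (x - (z - unitVec κ)); positivity
      calc κ₀ / nrm (x - (z - unitVec κ)) ^ a * Real.exp (-(δ / n) * supNorm (x - (z - unitVec κ)))
          ≤ (2 ^ a * (κ₀ / nrm (x - z) ^ a)) * (Real.exp δ * E) := mul_le_mul t1 t2 (Real.exp_pos _).le (t10.trans t1)
        _ = _ := by ring
    -- the symmetric difference
    have d12 : |L x (z + unitVec κ) () () - L x (z - unitVec κ) () ()| ≤ (1 + 2 ^ a' * Real.exp δ) * (κ₁ / nrm (x - z) ^ a') * E := by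
      have e : L x (z + unitVec κ) () () - L x (z - unitVec κ) () ()
          = (L x (z + unitVec κ) () () - L x z () ()) + (L x z () () - L x (z - unitVec κ) () ()) := by ring
      rw [e]
      refine (abs_add_le _ _).trans ?_
      have := add_le_add d1 d2
      refine this.trans (le_of_eq ?_)
      ring
    -- assemble
    have hwz := hw κ z
    have hdwz := hdw κ z
    have p1 : |w κ z * (L x (z + unitVec κ) () () - L x (z - unitVec κ) () ())|
        ≤ (A * W) * ((1 + 2 ^ a' * Real.exp δ) * (κ₁ / nrm (x - z) ^ a') * E) := by
      rw [abs_mul]; exact mul_le_mul hwz d12 (abs_nonneg _) ((abs_nonneg _).trans hwz)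
    have p2 : |(w κ z - w κ (z - unitVec κ)) * L x (z - unitVec κ) () ()| ≤ (A' * W) * (2 ^ a * Real.exp δ * (κ₀ / nrm (x - z) ^ a) * E) := by
      rw [abs_mul]; exact mul_le_mul hdwz d3 (abs_nonneg _) ((abs_nonneg _).trans hdwz)
    refine (abs_add_le _ _).trans ((add_le_add p1 p2).trans (le_of_eq ?_))
    ring
  rw [comp_gW_eq_oriented]
  refine (Finset.abs_sum_le_sum_abs _ _).trans ?_
  refine (Finset.sum_le_sum fun κ _ => hκ κ).trans (le_of_eq ?_)
  rw [Finset.sum_const, Finset.card_univ, Fintype.card_fin]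
  simp only [nsmul_eq_mul]
  push_cast; ring

/-- [folklore] **THE LEFT-END MAJORANT (mirror).**  VALUE profile as above, LEFT-DIFFERENCE profile `|L (x+e_μ) y − L x y| ≤ κ₁∕nrm(x−y)^{a′}·e^{…}`;
column densities centred on the FIRST variable ⟹
`|comp (gW w) L x z| ≤ (4·(1 + 2^{a′}·e^{δ})·A·κ₁∕nrm(x−z)^{a′} + 4·2^{a}·e^{δ}·A′·κ₀∕nrm(x−z)^{a})·e^{−(δ∕n)‖x−z‖∞}·e^{−(σ∕n)‖x−C‖∞}`. -/
theorem abs_gW_comp_le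
    (hL : ∀ x y, |L x y () ()| ≤ κ₀ / nrm (x - y) ^ a * Real.exp (-(δ / n) * supNorm (x - y)))
    (hdL : ∀ x y (μ : Fin 4), |L (x + unitVec μ) y () () - L x y () ()| ≤ κ₁ / nrm (x - y) ^ a' * Real.exp (-(δ / n) * supNorm (x - y)))
    (hw : ∀ κ x, |w κ x| ≤ A * Real.exp (-(σ / n) * supNorm (x - C)))
    (hdw : ∀ κ x, |w κ x - w κ (x - unitVec κ)| ≤ A' * Real.exp (-(σ / n) * supNorm (x - C)))
    (x z : Site 4) (a₀ b₀ : Unit) :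
    |comp (gW w) L x z a₀ b₀| ≤ (4 * (1 + 2 ^ a' * Real.exp δ) * A * κ₁ / nrm (x - z) ^ a' + 4 * 2 ^ a * Real.exp δ * A' * κ₀ / nrm (x - z) ^ a)
      * Real.exp (-(δ / n) * supNorm (x - z)) * Real.exp (-(σ / n) * supNorm (x - C)) := by
  have hn0 : (0 : ℝ) < n := by exact_mod_cast hn
  have hδn : 0 ≤ δ / n := div_nonneg hδ hn0.le
  have hδn' : Real.exp (δ / n * (1 : ℕ)) ≤ Real.exp δ := by
    rw [Nat.cast_one, mul_one]; exact Real.exp_le_exp.2 (div_le_self hδ (by exact_mod_cast hn))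
  set E : ℝ := Real.exp (-(δ / n) * supNorm (x - z)) with hE
  set W : ℝ := Real.exp (-(σ / n) * supNorm (x - C)) with hW
  have hE0 : 0 ≤ E := (Real.exp_pos _).le
  have hW0 : 0 ≤ W := (Real.exp_pos _).le
  have hq := nrm_pos (x - z)
  -- the profile in the first variable: `nrm (x' − z)` with `x' = x − e_κ` near `x`
  have hκ : ∀ κ : Fin 4, |(-(w κ x * (L (x + unitVec κ) z () () - L (x - unitVec κ) z () ()))
      - (w κ x - w κ (x - unitVec κ)) * L (x - unitVec κ) z () ())|
      ≤ ((1 + 2 ^ a' * Real.exp δ) * A * κ₁ / nrm (x - z) ^ a' + 2 ^ a * Real.exp δ * A' * κ₀ / nrm (x - z) ^ a) * E * W := by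
    intro κ
    -- `nrm ((x − e) − z)` vs `nrm (x − z)`: write both as `nrm (z' − ·)`-free forms via `nrm_neg`
    have hnear : supNorm (x - unitVec κ - x) ≤ 1 := supNorm_sub_unitVec_sub_le x κ
    have hpow' : 1 / nrm (x - unitVec κ - z) ^ a' ≤ (((1 : ℕ) : ℝ) + 1) ^ a' / nrm (x - z) ^ a' := by
      have h := inv_nrm_pow_le_of_near (x := z) hnear a'
      rwa [show z - (x - unitVec κ) = -(x - unitVec κ - z) by abel, PoissonInterior.nrm_neg,
        show z - x = -(x - z) by abel, PoissonInterior.nrm_neg] at h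
    have hpow : 1 / nrm (x - unitVec κ - z) ^ a ≤ (((1 : ℕ) : ℝ) + 1) ^ a / nrm (x - z) ^ a := by
      have h := inv_nrm_pow_le_of_near (x := z) hnear a
      rwa [show z - (x - unitVec κ) = -(x - unitVec κ - z) by abel, PoissonInterior.nrm_neg,
        show z - x = -(x - z) by abel, PoissonInterior.nrm_neg] at h
    have hexp : Real.exp (-(δ / n) * supNorm (x - unitVec κ - z)) ≤ Real.exp (δ / n * (1 : ℕ)) * E := by
      have h := (exp_shift_of_near (x := z) (w := C) hnear hδn).1
      rwa [show z - (x - unitVec κ) = -(x - unitVec κ - z) by abel, supNorm_neg, show z - x = -(x - z) by abel, supNorm_neg] at h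
    have d1 : |L (x + unitVec κ) z () () - L x z () ()| ≤ κ₁ / nrm (x - z) ^ a' * E := hdL x z κ
    have d2 : |L x z () () - L (x - unitVec κ) z () ()| ≤ 2 ^ a' * Real.exp δ * (κ₁ / nrm (x - z) ^ a') * E := by
      have h := hdL (x - unitVec κ) z κ
      rw [sub_add_cancel] at h
      refine h.trans ?_
      have t1 : κ₁ / nrm (x - unitVec κ - z) ^ a' ≤ 2 ^ a' * (κ₁ / nrm (x - z) ^ a') := by
        have := mul_le_mul_of_nonneg_left hpow' hκ₁
        calc κ₁ / nrm (x - unitVec κ - z) ^ a' = κ₁ * (1 / nrm (x - unitVec κ - z) ^ a') := by ring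
          _ ≤ κ₁ * ((((1 : ℕ) : ℝ) + 1) ^ a' / nrm (x - z) ^ a') := this
          _ = 2 ^ a' * (κ₁ / nrm (x - z) ^ a') := by norm_num; ring
      have t2 : Real.exp (-(δ / n) * supNorm (x - unitVec κ - z)) ≤ Real.exp δ * E :=
        hexp.trans (mul_le_mul_of_nonneg_right hδn' hE0)
      have t10 : 0 ≤ κ₁ / nrm (x - unitVec κ - z) ^ a' := by have := nrm_pos (x - unitVec κ - z); positivity
      calc κ₁ / nrm (x - unitVec κ - z) ^ a' * Real.exp (-(δ / n) * supNorm (x - unitVec κ - z))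
          ≤ (2 ^ a' * (κ₁ / nrm (x - z) ^ a')) * (Real.exp δ * E) := mul_le_mul t1 t2 (Real.exp_pos _).le (t10.trans t1)
        _ = _ := by ring
    have d3 : |L (x - unitVec κ) z () ()| ≤ 2 ^ a * Real.exp δ * (κ₀ / nrm (x - z) ^ a) * E := by
      have h := hL (x - unitVec κ) z
      refine h.trans ?_
      have t1 : κ₀ / nrm (x - unitVec κ - z) ^ a ≤ 2 ^ a * (κ₀ / nrm (x - z) ^ a) := by
        have := mul_le_mul_of_nonneg_left hpow hκ₀
        calc κ₀ / nrm (x - unitVec κ - z) ^ a = κ₀ * (1 / nrm (x - unitVec κ - z) ^ a) := by ring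
          _ ≤ κ₀ * ((((1 : ℕ) : ℝ) + 1) ^ a / nrm (x - z) ^ a) := this
          _ = 2 ^ a * (κ₀ / nrm (x - z) ^ a) := by norm_num; ring
      have t2 : Real.exp (-(δ / n) * supNorm (x - unitVec κ - z)) ≤ Real.exp δ * E :=
        hexp.trans (mul_le_mul_of_nonneg_right hδn' hE0)
      have t10 : 0 ≤ κ₀ / nrm (x - unitVec κ - z) ^ a := by have := nrm_pos (x - unitVec κ - z); positivity
      calc κ₀ / nrm (x - unitVec κ - z) ^ a * Real.exp (-(δ / n) * supNorm (x - unitVec κ - z))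
          ≤ (2 ^ a * (κ₀ / nrm (x - z) ^ a)) * (Real.exp δ * E) := mul_le_mul t1 t2 (Real.exp_pos _).le (t10.trans t1)
        _ = _ := by ring
    have d12 : |L (x + unitVec κ) z () () - L (x - unitVec κ) z () ()| ≤ (1 + 2 ^ a' * Real.exp δ) * (κ₁ / nrm (x - z) ^ a') * E := by
      have e : L (x + unitVec κ) z () () - L (x - unitVec κ) z () ()
          = (L (x + unitVec κ) z () () - L x z () ()) + (L x z () () - L (x - unitVec κ) z () ()) := by ring
      rw [e]
      refine (abs_add_le _ _).trans ((add_le_add d1 d2).trans (le_of_eq ?_))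
      ring
    have hwx := hw κ x
    have hdwx := hdw κ x
    have p1 : |(-(w κ x * (L (x + unitVec κ) z () () - L (x - unitVec κ) z () ())))|
        ≤ (A * W) * ((1 + 2 ^ a' * Real.exp δ) * (κ₁ / nrm (x - z) ^ a') * E) := by
      rw [abs_neg, abs_mul]; exact mul_le_mul hwx d12 (abs_nonneg _) ((abs_nonneg _).trans hwx)
    have p2 : |(w κ x - w κ (x - unitVec κ)) * L (x - unitVec κ) z () ()| ≤ (A' * W) * (2 ^ a * Real.exp δ * (κ₀ / nrm (x - z) ^ a) * E) := by
      rw [abs_mul]; exact mul_le_mul hdwx d3 (abs_nonneg _) ((abs_nonneg _).trans hdwx)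
    refine (abs_sub _ _).trans ((add_le_add p1 p2).trans (le_of_eq ?_))
    ring
  rw [gW_comp_eq_oriented]
  refine (Finset.abs_sum_le_sum_abs _ _).trans ?_
  refine (Finset.sum_le_sum fun κ _ => hκ κ).trans (le_of_eq ?_)
  rw [Finset.sum_const, Finset.card_univ, Fintype.card_fin]
  simp only [nsmul_eq_mul]
  push_cast; ring

end Majorant

end Summit.QuantumFields.BalabanUV.Beta.D1BFx.GhostVertexOrientation

end
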